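import Mathlib
import Summits.KontsevichZagierPeriods.Zeta5Search.ThirdDigitSeries
import Summits.KontsevichZagierPeriods.Zeta5Search.PadicFourthOrder
import HarnessLib

/-!
# ζ(5) search — THEOREM B TO FOURTH ORDER: the fourth `p`-adic digit of the partial-fraction coefficients

Cell `pub-zeta5` (HONEST FRAMING: systematic search; no irrationality claim unless certified), gen-2 seat generation 15
(REPORT-gen2-g15 §3).  Part 1 of the Lean proof of the CLASSWISE FOURTH-DIGIT LEMMAS (W4)/(V4) (`SecondResidueLaw.FourthDigitW/V`,
gen-2 g13/g14, staged) — `ThirdDigitSeries.lean` (typer g12, `leadingDigit₃`) one Taylor order further: the far part of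
`Gser = Gnear · Gfar` is expanded to third order,
`Gfar = ĝ_q + ĝ_qφ_q·X + ĝ_qc_q·X² + ĝ_qc₃,q·X³ + O(X⁴)` with **`[X³] Gfar = ĝ_q · c₃,q`**,
`c₃,q = (φ_q³ − 3φ_qφ₂,q + 2φ₃,q)/6` (`φ₃ = phi3Expl`, `PadicFourthOrder.lean`; `coeff_three_Gfar`: the third logarithmic
coefficient of a finite product of binomial series, `coeff_three_prod`), whence the EXACT-PLUS-ERROR form
`c_{σ−1,q} = (−p)^{σ+E_x} ĝ_q (ρ_{q,σ} − pφ_qρ_{q,σ+1} + p²c_qρ_{q,σ+2} − p³c₃,qρ_{q,σ+3}) + O(p^{σ+E_x+4})`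
(brackets `[σ+k ≤ n_q]` understood; `leadingDigit₄`, in `padicNorm` form).  Power-series algebra over `ℚ` and the slope bounds
of `PadicCoeffBound`; nothing here concerns irrationality.
-/

noncomputable section

open Finset PowerSeries

namespace Summit.KontsevichZagierPeriods.Zeta5Search.SecondOrder

open Summit.KontsevichZagierPeriods.Zeta5Search.DualSeries (InBox)
open Summit.KontsevichZagierPeriods.Zeta5Search.WedgeDictionary (pfData)
open Summit.KontsevichZagierPeriods.Zeta5Search.CasoratianValuation (InPolytope)
open Summit.KontsevichZagierPeriods.Zeta5Search.ClusterValuation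
open Summit.KontsevichZagierPeriods.Zeta5Search.PadicSeries

variable {p : ℕ} [hp : Fact p.Prime]

/-! ### The third Taylor coefficient of a finite product -/

omit hp in
/-- `[X³](A·B) = [X⁰]A·[X³]B + [X¹]A·[X²]B + [X²]A·[X¹]B + [X³]A·[X⁰]B`. -/
theorem coeff_three_mul' (A B : PowerSeries ℚ) :
    coeff 3 (A * B) = coeff 0 A * coeff 3 B + coeff 1 A * coeff 2 B + coeff 2 A * coeff 1 B + coeff 3 A * coeff 0 B := by
  rw [coeff_mul, Nat.sum_antidiagonal_eq_sum_range_succ_mk, sum_range_succ, sum_range_succ, sum_range_succ, sum_range_succ,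
    sum_range_zero]
  simp

omit hp in
/-- **Third logarithmic coefficient of a finite product**: if every constant term is non-zero, with `f_i = [X¹]F_i/[X⁰]F_i`,
`g_i = [X²]F_i/[X⁰]F_i`, `h_i = [X³]F_i/[X⁰]F_i`,
`[X³]∏ F_i = (∏ [X⁰]F_i) · (Σh + (Σf)(Σg) − Σfg + ((Σf)³ − 3(Σf)(Σf²) + 2Σf³)/6)`. -/
theorem coeff_three_prod {ι : Type*} (s : Finset ι) (F : ι → PowerSeries ℚ) (h0 : ∀ i ∈ s, coeff 0 (F i) ≠ 0) :
    coeff 3 (∏ i ∈ s, F i) = (∏ i ∈ s, coeff 0 (F i)) *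
      ((∑ i ∈ s, coeff 3 (F i) / coeff 0 (F i))
        + (∑ i ∈ s, coeff 1 (F i) / coeff 0 (F i)) * (∑ i ∈ s, coeff 2 (F i) / coeff 0 (F i))
        - (∑ i ∈ s, coeff 1 (F i) / coeff 0 (F i) * (coeff 2 (F i) / coeff 0 (F i)))
        + ((∑ i ∈ s, coeff 1 (F i) / coeff 0 (F i)) ^ 3
            - 3 * (∑ i ∈ s, coeff 1 (F i) / coeff 0 (F i)) * (∑ i ∈ s, (coeff 1 (F i) / coeff 0 (F i)) ^ 2)
            + 2 * ∑ i ∈ s, (coeff 1 (F i) / coeff 0 (F i)) ^ 3) / 6) := by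
  classical
  induction s using Finset.induction_on with
  | empty => simp
  | insert a s ha ih =>
    simp only [prod_insert ha, sum_insert ha]
    rw [coeff_three_mul', coeff_zero_prod', coeff_one_prod s _ (fun i hi => h0 i (mem_insert_of_mem hi)),
      coeff_two_prod s _ (fun i hi => h0 i (mem_insert_of_mem hi)), ih fun i hi => h0 i (mem_insert_of_mem hi)]
    have ha0 : coeff 0 (F a) ≠ 0 := h0 a (mem_insert_self a s)
    field_simp
    ring

/-! ### The far factors to third order -/

omit hp in
/-- `C(r, 3) = r(r−1)(r−2)/6` for the generalised binomial coefficient in `ℚ`. -/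
theorem ratChoose_three (r : ℚ) : Ring.choose r 3 = r * (r - 1) * (r - 2) / 6 := by
  rw [Ring.choose_eq_smul, smul_eq_mul, show (3 : ℕ) = 2 + 1 from rfl, descPochhammer_succ_right,
    show (2 : ℕ) = 1 + 1 from rfl, descPochhammer_succ_right, descPochhammer_one,
    Polynomial.smeval_mul, Polynomial.smeval_mul, Polynomial.smeval_sub, Polynomial.smeval_sub, Polynomial.smeval_X,
    Polynomial.smeval_natCast, Polynomial.smeval_natCast]
  simp
  ring

omit hp in
/-- `[X³]` of a far factor: `e(e−1)(e−2)/6 · (s−q)^{e − 3}` (`e = netExp s`). -/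
theorem coeff_three_factorS (b : ℕ → ℤ) {q s : ℕ} (hsq : s ≠ q) :
    coeff 3 (factorS b q s)
      = (netExp b s : ℚ) * (netExp b s - 1) * (netExp b s - 2) / 6 * ((s : ℚ) - q) ^ (netExp b s - 3) := by
  rw [factorS_eq_binomSeries b hsq, coeff_binomSeries, ratChoose_three]
  push_cast
  ring

/-! ### `[X³] Gfar = ĝ_q · c₃,q` -/

omit hp in
/-- `[X³]` of a constant vanishes. -/
theorem coeff_three_C (c : ℚ) : coeff 3 (C c) = 0 := by
  rw [coeff_C, if_neg (by norm_num)]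

omit hp in
/-- **The third Taylor coefficient of the far part is `ĝ_q · c₃,q`**, `c₃,q = (φ_q³ − 3φ_qφ₂,q + 2φ₃,q)/6` (`φ₃ = phi3Expl`). -/
theorem coeff_three_Gfar (b : ℕ → ℤ) (h0 : 0 ≤ b 0) {q : ℕ} (hq : q ≤ (b 0).toNat) :
    coeff 3 (Gfar b p q)
      = gHat b p q * ((phiHat b p q ^ 3 - 3 * phiHat b p q * phi2Hat b p q + 2 * phi3Expl b p q) / 6) := by
  have hb0 : ((((b 0).toNat : ℕ) : ℚ)) = ((b 0 : ℤ) : ℚ) := by exact_mod_cast Int.toNat_of_nonneg h0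
  set S := (range ((b 0).toNat + 1)).filter (fun s => s % p ≠ q % p) with hS
  have hSfar : ((range ((b 0).toNat + 1)).erase q).filter (fun s : ℕ => ¬ (p : ℤ) ∣ (s : ℤ) - q) = S := by
    rw [hS, farSet_eq b hq]
  have hne : ∀ s ∈ S, s ≠ q := by
    intro s hs h; subst h; exact (mem_filter.1 hs).2 rfl
  have hδ : ∀ s ∈ S, ((s : ℚ) - q) ≠ 0 := fun s hs => sub_ne_zero.2 (by exact_mod_cast hne s hs)
  have h0S : ∀ s ∈ S, coeff 0 (factorS b q s) ≠ 0 := by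
    intro s hs
    rw [coeff_zero_factorS b (hne s hs)]
    exact zpow_ne_zero _ (hδ s hs)
  have hP0 : coeff 0 (∏ s ∈ S, factorS b q s) = ∏ s ∈ S, ((s : ℚ) - q) ^ netExp b s := by
    rw [coeff_zero_prod']
    exact prod_congr rfl fun s hs => coeff_zero_factorS b (hne s hs)
  have hf : ∀ s ∈ S, coeff 1 (factorS b q s) / coeff 0 (factorS b q s) = (netExp b s : ℚ) / ((s : ℚ) - q) := by
    intro s hs
    rw [coeff_one_factorS b (hne s hs), coeff_zero_factorS b (hne s hs), zpow_sub_one₀ (hδ s hs)]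
    have hz : ((s : ℚ) - q) ^ netExp b s ≠ 0 := zpow_ne_zero _ (hδ s hs)
    field_simp
  have hQ : ∑ s ∈ S, coeff 1 (factorS b q s) / coeff 0 (factorS b q s) = ∑ s ∈ S, (netExp b s : ℚ) / ((s : ℚ) - q) :=
    sum_congr rfl hf
  have hQsq : ∑ s ∈ S, (coeff 1 (factorS b q s) / coeff 0 (factorS b q s)) ^ 2
      = ∑ s ∈ S, ((netExp b s : ℚ) / ((s : ℚ) - q)) ^ 2 := sum_congr rfl fun s hs => by rw [hf s hs]
  have hQcu : ∑ s ∈ S, (coeff 1 (factorS b q s) / coeff 0 (factorS b q s)) ^ 3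
      = ∑ s ∈ S, ((netExp b s : ℚ) / ((s : ℚ) - q)) ^ 3 := sum_congr rfl fun s hs => by rw [hf s hs]
  -- termwise second and third logarithmic coefficients
  have hterm2 : ∀ s ∈ S, coeff 2 (factorS b q s) / coeff 0 (factorS b q s)
      = (((netExp b s : ℚ) / ((s : ℚ) - q)) ^ 2 - (netExp b s : ℚ) / ((s : ℚ) - q) ^ 2) / 2 := by
    intro s hs
    rw [coeff_two_factorS b (hne s hs), coeff_zero_factorS b (hne s hs), zpow_sub₀ (hδ s hs)]
    have h2 : ((s : ℚ) - q) ^ (2 : ℤ) = ((s : ℚ) - q) ^ 2 := zpow_ofNat _ 2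
    rw [h2]
    have hz : ((s : ℚ) - q) ^ netExp b s ≠ 0 := zpow_ne_zero _ (hδ s hs)
    have hδs := hδ s hs
    field_simp
  have hterm3 : ∀ s ∈ S, coeff 3 (factorS b q s) / coeff 0 (factorS b q s)
      = (((netExp b s : ℚ) / ((s : ℚ) - q)) ^ 3 - 3 * ((netExp b s : ℚ) / ((s : ℚ) - q)) * ((netExp b s : ℚ) / ((s : ℚ) - q) ^ 2)
          + 2 * ((netExp b s : ℚ) / ((s : ℚ) - q) ^ 3)) / 6 := by
    intro s hs
    rw [coeff_three_factorS b (hne s hs), coeff_zero_factorS b (hne s hs), zpow_sub₀ (hδ s hs)]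
    have h3 : ((s : ℚ) - q) ^ (3 : ℤ) = ((s : ℚ) - q) ^ 3 := zpow_ofNat _ 3
    rw [h3]
    have hz : ((s : ℚ) - q) ^ netExp b s ≠ 0 := zpow_ne_zero _ (hδ s hs)
    have hδs := hδ s hs
    field_simp
    ring
  have hG : ∑ s ∈ S, coeff 2 (factorS b q s) / coeff 0 (factorS b q s)
      = ((∑ s ∈ S, ((netExp b s : ℚ) / ((s : ℚ) - q)) ^ 2) - ∑ s ∈ S, (netExp b s : ℚ) / ((s : ℚ) - q) ^ 2) / 2 := by
    rw [sum_congr rfl hterm2, ← sum_div, sum_sub_distrib]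
  have hFG : ∑ s ∈ S, coeff 1 (factorS b q s) / coeff 0 (factorS b q s) * (coeff 2 (factorS b q s) / coeff 0 (factorS b q s))
      = ((∑ s ∈ S, ((netExp b s : ℚ) / ((s : ℚ) - q)) ^ 3)
          - ∑ s ∈ S, ((netExp b s : ℚ) / ((s : ℚ) - q)) * ((netExp b s : ℚ) / ((s : ℚ) - q) ^ 2)) / 2 := by
    rw [← sum_sub_distrib, sum_div]
    refine sum_congr rfl fun s hs => ?_
    rw [hf s hs, hterm2 s hs]
    ring
  have hH : ∑ s ∈ S, coeff 3 (factorS b q s) / coeff 0 (factorS b q s)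
      = ((∑ s ∈ S, ((netExp b s : ℚ) / ((s : ℚ) - q)) ^ 3)
          - 3 * ∑ s ∈ S, ((netExp b s : ℚ) / ((s : ℚ) - q)) * ((netExp b s : ℚ) / ((s : ℚ) - q) ^ 2)
          + 2 * ∑ s ∈ S, (netExp b s : ℚ) / ((s : ℚ) - q) ^ 3) / 6 := by
    rw [sum_congr rfl hterm3, ← sum_div, sum_add_distrib, sum_sub_distrib, mul_sum, mul_sum]
    simp only [mul_assoc]
  have hP3 : coeff 3 (∏ s ∈ S, factorS b q s) =
      (∏ s ∈ S, ((s : ℚ) - q) ^ netExp b s) *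
        (((∑ s ∈ S, (netExp b s : ℚ) / ((s : ℚ) - q)) ^ 3
          - 3 * (∑ s ∈ S, (netExp b s : ℚ) / ((s : ℚ) - q)) * (∑ s ∈ S, (netExp b s : ℚ) / ((s : ℚ) - q) ^ 2)
          + 2 * ∑ s ∈ S, (netExp b s : ℚ) / ((s : ℚ) - q) ^ 3) / 6) := by
    rw [coeff_three_prod S _ h0S, ← hP0, coeff_zero_prod', hQ, hQsq, hQcu, hG, hFG, hH]
    ring
  have hP2 : coeff 2 (∏ s ∈ S, factorS b q s) =
      (∏ s ∈ S, ((s : ℚ) - q) ^ netExp b s) *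
        (((∑ s ∈ S, (netExp b s : ℚ) / ((s : ℚ) - q)) ^ 2 - ∑ s ∈ S, (netExp b s : ℚ) / ((s : ℚ) - q) ^ 2) / 2) := by
    rw [coeff_two_prod S _ h0S, ← hP0, coeff_zero_prod', hQ, hQsq, hG]
    ring
  have hP1 : coeff 1 (∏ s ∈ S, factorS b q s) =
      (∏ s ∈ S, ((s : ℚ) - q) ^ netExp b s) * ∑ s ∈ S, (netExp b s : ℚ) / ((s : ℚ) - q) := by
    rw [coeff_one_prod S _ h0S, ← hP0, coeff_zero_prod', hQ]
  have hC1 : ∀ c : ℚ, coeff 1 (C c) = 0 := fun c => by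
    rw [show (1 : ℕ) = 0 + 1 from rfl, coeff_C, if_neg (by norm_num)]
  have hg : gHat b p q = 2 * (∏ s ∈ S, ((s : ℚ) - q) ^ netExp b s) *
      (if ¬ (2 : ℤ) ∣ b 0 ∧ ¬ CentreIn b p q then ((b 0 : ℤ) : ℚ) / 2 - q else 1) := rfl
  have hφ : phiHat b p q = (∑ s ∈ S, (netExp b s : ℚ) / ((s : ℚ) - q))
      + (if ¬ (2 : ℤ) ∣ b 0 ∧ ¬ CentreIn b p q then 1 / (((b 0 : ℤ) : ℚ) / 2 - q) else 0) := rfl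
  have hφ2 : phi2Hat b p q = (∑ s ∈ S, (netExp b s : ℚ) / ((s : ℚ) - q) ^ 2)
      + (if ¬ (2 : ℤ) ∣ b 0 ∧ ¬ CentreIn b p q then 1 / (((b 0 : ℤ) : ℚ) / 2 - q) ^ 2 else 0) := rfl
  have hφ3 : phi3Expl b p q = (∑ s ∈ S, (netExp b s : ℚ) / ((s : ℚ) - q) ^ 3)
      + (if ¬ (2 : ℤ) ∣ b 0 ∧ ¬ CentreIn b p q then 1 / (((b 0 : ℤ) : ℚ) / 2 - q) ^ 3 else 0) := rfl
  rw [Gfar, hSfar, coeff_three_mul', hP0, hP1, hP2, hP3, hg, hφ, hφ2, hφ3]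
  generalize (∏ s ∈ S, ((s : ℚ) - q) ^ netExp b s) = P
  generalize (∑ s ∈ S, (netExp b s : ℚ) / ((s : ℚ) - q)) = Q
  generalize (∑ s ∈ S, (netExp b s : ℚ) / ((s : ℚ) - q) ^ 2) = Q₂
  generalize (∑ s ∈ S, (netExp b s : ℚ) / ((s : ℚ) - q) ^ 3) = Q₃
  by_cases hc : ¬ (2 : ℤ) ∣ b 0 ∧ CentreIn b p q
  · -- odd `b₀`, centre inside the class: the far centre factor is the constant `2`
    rw [if_pos hc, if_neg (fun h => h.2 hc.2), if_neg (fun h => h.2 hc.2), if_neg (fun h => h.2 hc.2),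
      if_neg (fun h => h.2 hc.2), coeff_zero_C, hC1, coeff_two_C, coeff_three_C]
    ring
  · rw [if_neg hc]
    by_cases hev : (2 : ℤ) ∣ b 0
    · -- even `b₀`: centre factor `2`
      rw [if_neg (fun h => h.1 hev), if_neg (fun h => h.1 hev), if_neg (fun h => h.1 hev), if_neg (fun h => h.1 hev), cenP,
        if_pos hev, Polynomial.coe_C, coeff_zero_C, hC1, coeff_two_C, coeff_three_C]
      ring
    · -- odd `b₀`, centre outside the class: centre factor `2X + (b₀ − 2q)`
      have hnc : ¬ CentreIn b p q := fun h => hc ⟨hev, h⟩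
      have hcq : ((b 0 : ℤ) : ℚ) / 2 - q ≠ 0 := by
        intro h
        apply hnc
        have h2 : (2 * (q : ℤ) - b 0 : ℤ) = 0 := by
          have : (2 * (q : ℚ) - (b 0 : ℚ)) = 0 := by linarith
          exact_mod_cast this
        exact ⟨0, by rw [h2]; ring⟩
      have e0 : coeff 0 ((cenP b q : Polynomial ℚ) : PowerSeries ℚ) = ((b 0 : ℤ) : ℚ) - 2 * q := by
        rw [cenP, if_neg hev, Polynomial.coe_add, Polynomial.coe_mul, Polynomial.coe_C, Polynomial.coe_X,
          Polynomial.coe_C, map_add, coeff_zero_C, coeff_zero_eq_constantCoeff_apply, map_mul, constantCoeff_X,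
          mul_zero, zero_add, hb0]
      have e1 : coeff 1 ((cenP b q : Polynomial ℚ) : PowerSeries ℚ) = 2 := by
        rw [cenP, if_neg hev, Polynomial.coe_add, Polynomial.coe_mul, Polynomial.coe_C, Polynomial.coe_X,
          Polynomial.coe_C, map_add, hC1, add_zero, mul_comm, show (1 : ℕ) = 0 + 1 from rfl, coeff_succ_X_mul,
          coeff_zero_C]
      have e2 : coeff 2 ((cenP b q : Polynomial ℚ) : PowerSeries ℚ) = 0 := by
        rw [cenP, if_neg hev, Polynomial.coe_add, Polynomial.coe_mul, Polynomial.coe_C, Polynomial.coe_X,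
          Polynomial.coe_C, map_add, coeff_two_C, add_zero, mul_comm, show (2 : ℕ) = 1 + 1 from rfl, coeff_succ_X_mul,
          hC1]
      have e3 : coeff 3 ((cenP b q : Polynomial ℚ) : PowerSeries ℚ) = 0 := by
        rw [cenP, if_neg hev, Polynomial.coe_add, Polynomial.coe_mul, Polynomial.coe_C, Polynomial.coe_X,
          Polynomial.coe_C, map_add, coeff_three_C, add_zero, mul_comm, show (3 : ℕ) = 2 + 1 from rfl, coeff_succ_X_mul,
          coeff_two_C]
      have hcq2 : ((b 0 : ℤ) : ℚ) - (q : ℚ) * 2 ≠ 0 := by contrapose! hcq; linarith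
      have hcq3 : ((b 0 : ℤ) : ℚ) - 2 * (q : ℚ) ≠ 0 := by contrapose! hcq; linarith
      rw [if_pos ⟨hev, hnc⟩, if_pos ⟨hev, hnc⟩, if_pos ⟨hev, hnc⟩, if_pos ⟨hev, hnc⟩, e0, e1, e2, e3]
      field_simp
      ring

/-! ### The far part to fourth order -/

/-- `Gfar − ĝ_q − ĝ_qφ_q·X − ĝ_qc_q·X² − ĝ_qc₃,q·X³` has slope-`1` offset `4`: its first four coefficients vanish, the others are
`p`-integral. -/
theorem Gfar_sub_four_bound (b : ℕ → ℤ) (h0 : 0 ≤ b 0) {q : ℕ} (hq : q ≤ (b 0).toNat) (hn : (b 0).toNat < p ^ 2)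
    (hp2 : p ≠ 2) :
    CoeffBound p 1 4 (Gfar b p q - C (gHat b p q) - X * C (gHat b p q * phiHat b p q)
      - X ^ 2 * C (gHat b p q * curvHat b p q)
      - X ^ 3 * C (gHat b p q * ((phiHat b p q ^ 3 - 3 * phiHat b p q * phi2Hat b p q + 2 * phi3Expl b p q) / 6))) := by
  have hXC : ∀ (c : ℚ) (n k : ℕ), coeff k (X ^ n * C c) = if k = n then c else 0 := by
    intro c n k
    rw [coeff_X_pow_mul', coeff_C]
    by_cases h : k = n
    · subst h; simp
    · by_cases h2 : n ≤ k
      · rw [if_pos h2, if_neg (by omega), if_neg h]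
      · rw [if_neg h2, if_neg h]
  have hX1C : ∀ (c : ℚ) (k : ℕ), coeff k (X * C c) = if k = 1 then c else 0 := fun c k => by
    rw [← hXC c 1 k, pow_one]
  intro k
  rw [map_sub, map_sub, map_sub, map_sub, coeff_C, hX1C, hXC, hXC]
  rcases Nat.lt_or_ge k 4 with hk | hk
  · have hz : coeff k (Gfar b p q) - (if k = 0 then gHat b p q else 0) - (if k = 1 then gHat b p q * phiHat b p q else 0)
        - (if k = 2 then gHat b p q * curvHat b p q else 0)
        - (if k = 3 then gHat b p q * ((phiHat b p q ^ 3 - 3 * phiHat b p q * phi2Hat b p q + 2 * phi3Expl b p q) / 6)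
            else 0) = 0 := by
      interval_cases k
      · rw [coeff_zero_eq_constantCoeff_apply, constantCoeff_Gfar b h0 hq]; simp
      · rw [coeff_one_Gfar b h0 hq]; simp
      · rw [coeff_two_Gfar b h0 hq]; simp
      · rw [coeff_three_Gfar b h0 hq]; simp
    rw [hz, padicNorm.zero]
    exact zpow_p_nonneg _
  · rw [if_neg (by omega), if_neg (by omega), if_neg (by omega), if_neg (by omega), sub_zero, sub_zero, sub_zero, sub_zero]
    refine ((Gfar_integral b hq hn hp2) k).trans (zpow_le_zpow_right₀ one_le_p ?_)
    omega

/-- **THEOREM B TO FOURTH ORDER.** In the window `p² > b₀ + 2`, `p ≥ 5`, for a pole `q` of order `n_q = −netExp q` and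
`1 ≤ σ ≤ n_q`, with brackets `[σ+k] = [σ+k ≤ n_q]` and `c₃,q = (φ_q³ − 3φ_qφ₂,q + 2φ₃,q)/6`:
`‖c_{σ−1,q} − (−p)^{σ+E_x} ĝ_q (ρ_{q,σ} − pφ_qρ_{q,σ+1}[σ+1] + p²c_qρ_{q,σ+2}[σ+2] − p³c₃,qρ_{q,σ+3}[σ+3])‖_p`
`≤ p^{−(σ+E_x+4)}`. -/
theorem leadingDigit₄ (b : ℕ → ℤ) (hb : InPolytope b) (hp5 : 5 ≤ p) (hwin : (b 0 + 2 : ℤ) < (p : ℤ) ^ 2)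
    {q σ : ℕ} (hq : q ≤ (b 0).toNat) (hσ1 : 1 ≤ σ) (hσ : (σ : ℤ) ≤ -netExp b q) :
    padicNorm p (pfData b (σ - 1) q - (-(p : ℚ)) ^ ((σ : ℤ) + classExp b p q) * gHat b p q *
        (classRho b p q σ
          - (p : ℚ) * phiHat b p q * (if (σ : ℤ) + 1 ≤ -netExp b q then classRho b p q (σ + 1) else 0)
          + (p : ℚ) ^ 2 * curvHat b p q * (if (σ : ℤ) + 2 ≤ -netExp b q then classRho b p q (σ + 2) else 0)
          - (p : ℚ) ^ 3 * ((phiHat b p q ^ 3 - 3 * phiHat b p q * phi2Hat b p q + 2 * phi3Expl b p q) / 6)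
              * (if (σ : ℤ) + 3 ≤ -netExp b q then classRho b p q (σ + 3) else 0))) ≤
      (p : ℚ) ^ (-((σ : ℤ) + classExp b p q + 4)) := by
  obtain ⟨hbox, hhalf, hpf, hn⟩ := thmA_data b hb hwin
  have h0 : 0 ≤ b 0 := hbox.1
  have hp2 : p ≠ 2 := by omega
  have hp0 : p ≠ 0 := hp.out.ne_zero
  have hp' : (-(p : ℚ)) ≠ 0 := neg_ne_zero.2 (Nat.cast_ne_zero.2 hp0)
  have hm := mult_eq_netExp b q
  have hid := pf_eq_coeff_Gser b hbox hhalf hpf hq (show σ - 1 < 6 by omega)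
  rw [coeff_X_pow_mul', if_pos (by omega)] at hid
  set κ := 5 - (σ - 1) - mult b q with hκ
  set g := gHat b p q with hg
  set φ := phiHat b p q with hφ
  set cc := curvHat b p q with hcc
  set c₃ := (phiHat b p q ^ 3 - 3 * phiHat b p q * phi2Hat b p q + 2 * phi3Expl b p q) / 6 with hc₃
  set E := classExp b p q with hE
  -- split `Gser = Σ_{j ≤ 3} X^j·(Gnear·ĝe_j) + Gnear·R`
  set R := Gfar b p q - C g - X * C (g * φ) - X ^ 2 * C (g * cc) - X ^ 3 * C (g * c₃) with hR
  have hsplit : Gser b q = X ^ 0 * (Gnear b p q * C g) + X ^ 1 * (Gnear b p q * C (g * φ))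
      + X ^ 2 * (Gnear b p q * C (g * cc)) + X ^ 3 * (Gnear b p q * C (g * c₃)) + Gnear b p q * R := by
    rw [Gser_eq_near_mul_far b p q, hR]; ring
  -- the exact coefficients of the near part
  have hGk : ∀ k, coeff k (Gnear b p q) = (-(p : ℚ)) ^ (E - netExp b q - k) * coeff k (classCofactor b p q) := by
    intro k
    have hres := congrArg (coeff k) (rescale_Gnear hp0 b h0 hq)
    rw [coeff_rescale, coeff_C_mul] at hres
    have e1 : (-(p : ℚ)) ^ k = (-(p : ℚ)) ^ (k : ℤ) := (zpow_natCast _ _).symm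
    rw [e1] at hres
    have hk0 : (-(p : ℚ)) ^ (k : ℤ) ≠ 0 := zpow_ne_zero _ hp'
    rw [← mul_right_inj' hk0, hres, ← mul_assoc, ← zpow_add₀ hp']
    congr 2; ring
  -- one term `X^j · Gnear · ĝe_j` at the coefficient `κ = n_q − σ`
  have hterm : ∀ (j : ℕ) (a : ℚ), coeff κ (X ^ j * (Gnear b p q * C a)) =
      if (σ : ℤ) + j ≤ -netExp b q then (-(p : ℚ)) ^ ((σ : ℤ) + E) * (-(p : ℚ)) ^ j * a * classRho b p q (σ + j)
      else 0 := by
    intro j a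
    rw [coeff_X_pow_mul']
    by_cases hj : (σ : ℤ) + j ≤ -netExp b q
    · rw [if_pos (show j ≤ κ by omega), if_pos hj, coeff_mul_C, hGk (κ - j), classRho,
        show (-netExp b q).toNat - (σ + j) = κ - j by omega,
        show E - netExp b q - ((κ - j : ℕ) : ℤ) = ((σ : ℤ) + E) + (j : ℕ) by omega, zpow_add₀ hp',
        zpow_natCast]
      ring
    · rw [if_neg (show ¬ j ≤ κ by omega), if_neg hj]
  -- the exact fourth-order leading term
  have hlead : coeff κ (X ^ 0 * (Gnear b p q * C g) + X ^ 1 * (Gnear b p q * C (g * φ))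
      + X ^ 2 * (Gnear b p q * C (g * cc)) + X ^ 3 * (Gnear b p q * C (g * c₃))) =
      (-(p : ℚ)) ^ ((σ : ℤ) + E) * g *
        (classRho b p q σ - (p : ℚ) * φ * (if (σ : ℤ) + 1 ≤ -netExp b q then classRho b p q (σ + 1) else 0)
          + (p : ℚ) ^ 2 * cc * (if (σ : ℤ) + 2 ≤ -netExp b q then classRho b p q (σ + 2) else 0)
          - (p : ℚ) ^ 3 * c₃ * (if (σ : ℤ) + 3 ≤ -netExp b q then classRho b p q (σ + 3) else 0)) := by
    rw [map_add, map_add, map_add, hterm 0, hterm 1, hterm 2, hterm 3, if_pos (by push_cast; omega)]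
    push_cast
    rw [add_zero]
    split_ifs <;> ring
  -- the error term
  have herr : CoeffBound p 1 (E - netExp b q + 4) (Gnear b p q * R) :=
    (Gnear_bound b h0 hq hn hp2).mul (Gfar_sub_four_bound b h0 hq hn hp2)
  have hdiff : pfData b (σ - 1) q - (-(p : ℚ)) ^ ((σ : ℤ) + E) * g *
      (classRho b p q σ - (p : ℚ) * φ * (if (σ : ℤ) + 1 ≤ -netExp b q then classRho b p q (σ + 1) else 0)
        + (p : ℚ) ^ 2 * cc * (if (σ : ℤ) + 2 ≤ -netExp b q then classRho b p q (σ + 2) else 0)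
        - (p : ℚ) ^ 3 * c₃ * (if (σ : ℤ) + 3 ≤ -netExp b q then classRho b p q (σ + 3) else 0)) =
      coeff κ (Gnear b p q * R) := by
    rw [hid, hsplit, map_add, hlead]; ring
  rw [hdiff]
  refine (herr κ).trans (le_of_eq ?_)
  congr 1; omega

end Summit.KontsevichZagierPeriods.Zeta5Search.SecondOrder

end
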